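import Summits.CriticalPhenomena.Ising3DConformalLimit.Theses.SubPtolemyInterlacing
import Summits.CriticalPhenomena.Ising3DConformalLimit.Theorems.SubPtolemyInterlacingInterlacingReduction
import Summits.CriticalPhenomena.Ising3DConformalLimit.Theorems.SubPtolemyInterlacingInterlacingBalancedSuffices
import HarnessLib

/-!
# Line `Sketch` for the crux `SubPtolemyInterlacing.Interlacing` (stmt-CriticalPhenomena-15702) — the balanced family

THE REDUCTION ON THE LOAD-BEARING FAMILY, banked as theorems (lead c8, 2026-08-17).

The route `SubPtolemyInterlacing` consumes the all-gaps crux `Interlacing` (item 15702, now an aside) only through its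
Ptolemy-balanced instances `(a,b,c) = (2N, N, 3N)` — the axis quadruple `(0, 2N, 3N, 6N)·e₁`, cross-ratio `z = ½` — and
only eventually in `N`: that is item stmt-CriticalPhenomena-18014 `InterlacingEventualBalanced`
(`∃ N₀, ∀ N ≥ N₀, 1 ≤ N → S₄·P₂ ≤ P₁·P₃` at that quadruple), which with `SubPtolemyFloor` and `MoebiusLimit` gives the
sub-problem (`transfer_ising3D_of_balanced`, p140149).

The line's per-instance reduction `stub_reduction a b c : (engine at (a,b,c)) → SPC(a,b,c)` (p160563: GHS regime by the
GHS pivot floor, Lebowitz corner by Lebowitz' inequality, the window by the engine hypothesis + box switching identity +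
box limit) is here SPECIALISED to that family and composed with the transfer, so that the load-bearing item inherits from
the tree — not from a `Cruxes/` workfile — a one-hypothesis reduction whose conclusion is ITS signature verbatim:

* `stub_balancedReduction N` : the engine at `(2N,N,3N)` (gaps already summed: `3N = 2N+N`, `4N = N+3N`, `6N = 2N+N+3N`)
  gives the interlacing inequality at `(0,2N,3N,6N)·e₁` in item 18014's `Pi.single` spelling;
* `eventualBalanced_of_engineBalanced` : the engine eventually in `N` gives item 18014's statement verbatim;
* `ising3D_of_engineBalanced` : … and hence, with `SubPtolemyFloor` and `MoebiusLimit`, the sub-problem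
  `Ising3DConformalLimit` (through `transfer_ising3D_of_balanced`).

WHAT THE ENGINE SAYS on this family (the crux's open content, unchanged): granted `P₂ ≤ P₁` (`G(3N)G(4N) ≤ G(2N)G(3N)`),
`P₂ ≤ P₃` (`G(3N)G(4N) ≤ G(6N)G(N)`), the window `(P₁−P₂)(P₃−P₂) < 2P₂²` and the negated GHS criterion, eventually in `L`
the two INTERLACED sourced critical double currents `∂n₁ = {0, 3N e₁}`, `∂n₂ = {2N e₁, 6N e₁}` in the free box `Λ_L` merge
often enough: `P₂ᴸ(P₁ᴸ+P₂ᴸ+P₃ᴸ) − P₁ᴸP₃ᴸ ≤ 2(P₂ᴸ)²·𝐏[0 ↔ 2N e₁]`, i.e. `𝐏[merge] ≥ ι*_L = 1 − (u_L−1)(t_L−1)/2`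
(`→ 0.448` in the continuum at `2Δ = 1.036`); equivalently a scale-uniform `|U₄| ≥ 2ι*·G₁₃G₂₄ ≈ 0.9·G₁₃G₂₄` —
non-Gaussianity of the critical 3D Ising four-point function WITH A CONSTANT (open). Nothing in this file is conditional
on a named fact; no definitions, no sorry.
-/

noncomputable section

namespace Summit.CriticalPhenomena.Ising3DConformalLimit.Cruxes.Interlacing.Sketch

open Filter MeasureTheory
open scoped symmDiff Topology
open Literature.Probability.LatticeModels Literature.Probability.Percolation
open Summit.CriticalPhenomena.Ising3DConformalLimit.Theses.SubPtolemyInterlacing (SubPtolemyFloor MoebiusLimit)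
open Summit.CriticalPhenomena.Ising3DConformalLimit.Theorems (interlacingForcesU4_axSite_eq)

/-- **The balanced instance from the engine at that instance.** For `N : ℕ`, if the ENGINE of the line `Sketch`
holds at the balanced gaps `(2N, N, 3N)` — granted axial monotonicity `G(3N)G(4N) ≤ G(2N)G(3N)`, log-convexity
`G(3N)G(4N) ≤ G(6N)G(N)`, the window `(P₁−P₂)(P₃−P₂) < 2P₂²` and the negated GHS criterion (all for `criticalTwoPoint 3`),
the pattern inequality `P₂ᴸ(P₁ᴸ+P₂ᴸ+P₃ᴸ) − P₁ᴸP₃ᴸ ≤ 2(P₂ᴸ)²·𝐏^{x₁x₃,x₂x₄}_{Λ_L,β_c}[x₁ ↔ x₂]` holds in the free boxes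
eventually in `L` — then the interlacing (sub-Ptolemy) inequality holds for `criticalCorr 3` at the axis quadruple
`(0, 2N, 3N, 6N)·e₁`, in item stmt-CriticalPhenomena-18014's spelling. Proof: `stub_reduction (2N) N (3N)` (p160563) with
the gap sums `2N+N = 3N`, `N+3N = 4N`, `3N+3N = 6N` and the axis dictionary `(m:ℤ)•e₁ = Pi.single 0 m`. [folklore] -/
theorem stub_balancedReduction : ∀ N : ℕ,
    (criticalTwoPoint 3 (Pi.single 0 ((3 * N : ℕ) : ℤ)) * criticalTwoPoint 3 (Pi.single 0 ((4 * N : ℕ) : ℤ)) ≤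
      criticalTwoPoint 3 (Pi.single 0 ((2 * N : ℕ) : ℤ)) * criticalTwoPoint 3 (Pi.single 0 ((3 * N : ℕ) : ℤ)) →
    criticalTwoPoint 3 (Pi.single 0 ((3 * N : ℕ) : ℤ)) * criticalTwoPoint 3 (Pi.single 0 ((4 * N : ℕ) : ℤ)) ≤
      criticalTwoPoint 3 (Pi.single 0 ((6 * N : ℕ) : ℤ)) * criticalTwoPoint 3 (Pi.single 0 ((N : ℕ) : ℤ)) →
    (criticalTwoPoint 3 (Pi.single 0 ((2 * N : ℕ) : ℤ)) * criticalTwoPoint 3 (Pi.single 0 ((3 * N : ℕ) : ℤ)) -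
          criticalTwoPoint 3 (Pi.single 0 ((3 * N : ℕ) : ℤ)) * criticalTwoPoint 3 (Pi.single 0 ((4 * N : ℕ) : ℤ))) *
        (criticalTwoPoint 3 (Pi.single 0 ((6 * N : ℕ) : ℤ)) * criticalTwoPoint 3 (Pi.single 0 ((N : ℕ) : ℤ)) -
          criticalTwoPoint 3 (Pi.single 0 ((3 * N : ℕ) : ℤ)) * criticalTwoPoint 3 (Pi.single 0 ((4 * N : ℕ) : ℤ))) <
      2 * (criticalTwoPoint 3 (Pi.single 0 ((3 * N : ℕ) : ℤ)) * criticalTwoPoint 3 (Pi.single 0 ((4 * N : ℕ) : ℤ))) ^ 2 →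
    2 * max
          (max (criticalTwoPoint 3 (Pi.single 0 ((2 * N : ℕ) : ℤ)) * criticalTwoPoint 3 (Pi.single 0 ((3 * N : ℕ) : ℤ)) *
              criticalTwoPoint 3 (Pi.single 0 ((6 * N : ℕ) : ℤ)))
            (criticalTwoPoint 3 (Pi.single 0 ((2 * N : ℕ) : ℤ)) * criticalTwoPoint 3 (Pi.single 0 ((N : ℕ) : ℤ)) *
              criticalTwoPoint 3 (Pi.single 0 ((4 * N : ℕ) : ℤ))))
          (max (criticalTwoPoint 3 (Pi.single 0 ((3 * N : ℕ) : ℤ)) * criticalTwoPoint 3 (Pi.single 0 ((N : ℕ) : ℤ)) *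
              criticalTwoPoint 3 (Pi.single 0 ((3 * N : ℕ) : ℤ)))
            (criticalTwoPoint 3 (Pi.single 0 ((6 * N : ℕ) : ℤ)) * criticalTwoPoint 3 (Pi.single 0 ((4 * N : ℕ) : ℤ)) *
              criticalTwoPoint 3 (Pi.single 0 ((3 * N : ℕ) : ℤ)))) *
        (criticalTwoPoint 3 (Pi.single 0 ((3 * N : ℕ) : ℤ)) * criticalTwoPoint 3 (Pi.single 0 ((4 * N : ℕ) : ℤ))) <
      (criticalTwoPoint 3 (Pi.single 0 ((2 * N : ℕ) : ℤ)) * criticalTwoPoint 3 (Pi.single 0 ((3 * N : ℕ) : ℤ)) +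
          criticalTwoPoint 3 (Pi.single 0 ((3 * N : ℕ) : ℤ)) * criticalTwoPoint 3 (Pi.single 0 ((4 * N : ℕ) : ℤ)) +
          criticalTwoPoint 3 (Pi.single 0 ((6 * N : ℕ) : ℤ)) * criticalTwoPoint 3 (Pi.single 0 ((N : ℕ) : ℤ))) *
        (criticalTwoPoint 3 (Pi.single 0 ((3 * N : ℕ) : ℤ)) * criticalTwoPoint 3 (Pi.single 0 ((4 * N : ℕ) : ℤ))) -
      criticalTwoPoint 3 (Pi.single 0 ((2 * N : ℕ) : ℤ)) * criticalTwoPoint 3 (Pi.single 0 ((3 * N : ℕ) : ℤ)) *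
        (criticalTwoPoint 3 (Pi.single 0 ((6 * N : ℕ) : ℤ)) * criticalTwoPoint 3 (Pi.single 0 ((N : ℕ) : ℤ))) →
    ∀ᶠ L : ℕ in atTop,
      isingTwoPoint (zdGraph 3) (box 3 L) (criticalBeta 3) 0 .free (Pi.single 0 ((0 : ℕ) : ℤ)) (Pi.single 0 ((3 * N : ℕ) : ℤ)) *
            isingTwoPoint (zdGraph 3) (box 3 L) (criticalBeta 3) 0 .free (Pi.single 0 ((2 * N : ℕ) : ℤ)) (Pi.single 0 ((6 * N : ℕ) : ℤ)) *
          (isingTwoPoint (zdGraph 3) (box 3 L) (criticalBeta 3) 0 .free (Pi.single 0 ((0 : ℕ) : ℤ)) (Pi.single 0 ((2 * N : ℕ) : ℤ)) *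
            isingTwoPoint (zdGraph 3) (box 3 L) (criticalBeta 3) 0 .free (Pi.single 0 ((3 * N : ℕ) : ℤ)) (Pi.single 0 ((6 * N : ℕ) : ℤ)) +
            isingTwoPoint (zdGraph 3) (box 3 L) (criticalBeta 3) 0 .free (Pi.single 0 ((0 : ℕ) : ℤ)) (Pi.single 0 ((3 * N : ℕ) : ℤ)) *
            isingTwoPoint (zdGraph 3) (box 3 L) (criticalBeta 3) 0 .free (Pi.single 0 ((2 * N : ℕ) : ℤ)) (Pi.single 0 ((6 * N : ℕ) : ℤ)) +
            isingTwoPoint (zdGraph 3) (box 3 L) (criticalBeta 3) 0 .free (Pi.single 0 ((0 : ℕ) : ℤ)) (Pi.single 0 ((6 * N : ℕ) : ℤ)) *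
            isingTwoPoint (zdGraph 3) (box 3 L) (criticalBeta 3) 0 .free (Pi.single 0 ((2 * N : ℕ) : ℤ)) (Pi.single 0 ((3 * N : ℕ) : ℤ))) -
        isingTwoPoint (zdGraph 3) (box 3 L) (criticalBeta 3) 0 .free (Pi.single 0 ((0 : ℕ) : ℤ)) (Pi.single 0 ((2 * N : ℕ) : ℤ)) *
            isingTwoPoint (zdGraph 3) (box 3 L) (criticalBeta 3) 0 .free (Pi.single 0 ((3 * N : ℕ) : ℤ)) (Pi.single 0 ((6 * N : ℕ) : ℤ)) *
          (isingTwoPoint (zdGraph 3) (box 3 L) (criticalBeta 3) 0 .free (Pi.single 0 ((0 : ℕ) : ℤ)) (Pi.single 0 ((6 * N : ℕ) : ℤ)) *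
            isingTwoPoint (zdGraph 3) (box 3 L) (criticalBeta 3) 0 .free (Pi.single 0 ((2 * N : ℕ) : ℤ)) (Pi.single 0 ((3 * N : ℕ) : ℤ))) ≤
      2 * (isingTwoPoint (zdGraph 3) (box 3 L) (criticalBeta 3) 0 .free (Pi.single 0 ((0 : ℕ) : ℤ)) (Pi.single 0 ((3 * N : ℕ) : ℤ)) *
            isingTwoPoint (zdGraph 3) (box 3 L) (criticalBeta 3) 0 .free (Pi.single 0 ((2 * N : ℕ) : ℤ)) (Pi.single 0 ((6 * N : ℕ) : ℤ))) ^ 2 *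
          (sourcedDoubleCurrentLaw 3 L (criticalBeta 3) ({(Pi.single 0 ((0 : ℕ) : ℤ))} ∆ {(Pi.single 0 ((3 * N : ℕ) : ℤ))})
            ({(Pi.single 0 ((2 * N : ℕ) : ℤ))} ∆ {(Pi.single 0 ((6 * N : ℕ) : ℤ))})).real (openConn (Pi.single 0 ((0 : ℕ) : ℤ)) (Pi.single 0 ((2 * N : ℕ) : ℤ)))) →
      criticalCorr 3 4 ![Pi.single 0 ((0 : ℕ) : ℤ), Pi.single 0 ((2 * N : ℕ) : ℤ),
          Pi.single 0 ((3 * N : ℕ) : ℤ), Pi.single 0 ((6 * N : ℕ) : ℤ)] *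
          (criticalCorr 3 2 ![Pi.single 0 ((0 : ℕ) : ℤ), Pi.single 0 ((3 * N : ℕ) : ℤ)] *
            criticalCorr 3 2 ![Pi.single 0 ((2 * N : ℕ) : ℤ), Pi.single 0 ((6 * N : ℕ) : ℤ)]) ≤
        criticalCorr 3 2 ![Pi.single 0 ((0 : ℕ) : ℤ), Pi.single 0 ((2 * N : ℕ) : ℤ)] *
            criticalCorr 3 2 ![Pi.single 0 ((3 * N : ℕ) : ℤ), Pi.single 0 ((6 * N : ℕ) : ℤ)] *
          (criticalCorr 3 2 ![Pi.single 0 ((0 : ℕ) : ℤ), Pi.single 0 ((6 * N : ℕ) : ℤ)] *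
            criticalCorr 3 2 ![Pi.single 0 ((2 * N : ℕ) : ℤ), Pi.single 0 ((3 * N : ℕ) : ℤ)]) := by
  intro N hE
  have h := stub_reduction (2 * N) N (3 * N)
  have e3 : 2 * N + N = 3 * N := by ring
  have e4 : N + 3 * N = 4 * N := by ring
  have e6 : 3 * N + 3 * N = 6 * N := by ring
  rw [e3] at h
  rw [e4, e6] at h
  simp only [interlacingForcesU4_axSite_eq] at h
  exact h hE

/-- **Item stmt-CriticalPhenomena-18014 from the engine on the balanced family, eventually.** If there is `N₀` such
that the engine of the line `Sketch` holds at the balanced gaps `(2N, N, 3N)` for every `N ≥ N₀`, `N ≥ 1`, then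
`InterlacingEventualBalanced` holds — stated here VERBATIM as item 18014's signature (the route file rev 2 does not yet
declare the name). One application of `stub_balancedReduction` per scale. [folklore] -/
theorem eventualBalanced_of_engineBalanced (N₀ : ℕ)
    (hE : ∀ N : ℕ, N₀ ≤ N → 1 ≤ N →
      criticalTwoPoint 3 (Pi.single 0 ((3 * N : ℕ) : ℤ)) * criticalTwoPoint 3 (Pi.single 0 ((4 * N : ℕ) : ℤ)) ≤
        criticalTwoPoint 3 (Pi.single 0 ((2 * N : ℕ) : ℤ)) * criticalTwoPoint 3 (Pi.single 0 ((3 * N : ℕ) : ℤ)) →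
      criticalTwoPoint 3 (Pi.single 0 ((3 * N : ℕ) : ℤ)) * criticalTwoPoint 3 (Pi.single 0 ((4 * N : ℕ) : ℤ)) ≤
        criticalTwoPoint 3 (Pi.single 0 ((6 * N : ℕ) : ℤ)) * criticalTwoPoint 3 (Pi.single 0 ((N : ℕ) : ℤ)) →
      (criticalTwoPoint 3 (Pi.single 0 ((2 * N : ℕ) : ℤ)) * criticalTwoPoint 3 (Pi.single 0 ((3 * N : ℕ) : ℤ)) -
            criticalTwoPoint 3 (Pi.single 0 ((3 * N : ℕ) : ℤ)) * criticalTwoPoint 3 (Pi.single 0 ((4 * N : ℕ) : ℤ))) *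
          (criticalTwoPoint 3 (Pi.single 0 ((6 * N : ℕ) : ℤ)) * criticalTwoPoint 3 (Pi.single 0 ((N : ℕ) : ℤ)) -
            criticalTwoPoint 3 (Pi.single 0 ((3 * N : ℕ) : ℤ)) * criticalTwoPoint 3 (Pi.single 0 ((4 * N : ℕ) : ℤ))) <
        2 * (criticalTwoPoint 3 (Pi.single 0 ((3 * N : ℕ) : ℤ)) * criticalTwoPoint 3 (Pi.single 0 ((4 * N : ℕ) : ℤ))) ^ 2 →
      2 * max
            (max (criticalTwoPoint 3 (Pi.single 0 ((2 * N : ℕ) : ℤ)) * criticalTwoPoint 3 (Pi.single 0 ((3 * N : ℕ) : ℤ)) *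
                criticalTwoPoint 3 (Pi.single 0 ((6 * N : ℕ) : ℤ)))
              (criticalTwoPoint 3 (Pi.single 0 ((2 * N : ℕ) : ℤ)) * criticalTwoPoint 3 (Pi.single 0 ((N : ℕ) : ℤ)) *
                criticalTwoPoint 3 (Pi.single 0 ((4 * N : ℕ) : ℤ))))
            (max (criticalTwoPoint 3 (Pi.single 0 ((3 * N : ℕ) : ℤ)) * criticalTwoPoint 3 (Pi.single 0 ((N : ℕ) : ℤ)) *
                criticalTwoPoint 3 (Pi.single 0 ((3 * N : ℕ) : ℤ)))
              (criticalTwoPoint 3 (Pi.single 0 ((6 * N : ℕ) : ℤ)) * criticalTwoPoint 3 (Pi.single 0 ((4 * N : ℕ) : ℤ)) *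
                criticalTwoPoint 3 (Pi.single 0 ((3 * N : ℕ) : ℤ)))) *
          (criticalTwoPoint 3 (Pi.single 0 ((3 * N : ℕ) : ℤ)) * criticalTwoPoint 3 (Pi.single 0 ((4 * N : ℕ) : ℤ))) <
        (criticalTwoPoint 3 (Pi.single 0 ((2 * N : ℕ) : ℤ)) * criticalTwoPoint 3 (Pi.single 0 ((3 * N : ℕ) : ℤ)) +
            criticalTwoPoint 3 (Pi.single 0 ((3 * N : ℕ) : ℤ)) * criticalTwoPoint 3 (Pi.single 0 ((4 * N : ℕ) : ℤ)) +
            criticalTwoPoint 3 (Pi.single 0 ((6 * N : ℕ) : ℤ)) * criticalTwoPoint 3 (Pi.single 0 ((N : ℕ) : ℤ))) *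
          (criticalTwoPoint 3 (Pi.single 0 ((3 * N : ℕ) : ℤ)) * criticalTwoPoint 3 (Pi.single 0 ((4 * N : ℕ) : ℤ))) -
        criticalTwoPoint 3 (Pi.single 0 ((2 * N : ℕ) : ℤ)) * criticalTwoPoint 3 (Pi.single 0 ((3 * N : ℕ) : ℤ)) *
          (criticalTwoPoint 3 (Pi.single 0 ((6 * N : ℕ) : ℤ)) * criticalTwoPoint 3 (Pi.single 0 ((N : ℕ) : ℤ))) →
      ∀ᶠ L : ℕ in atTop,
        isingTwoPoint (zdGraph 3) (box 3 L) (criticalBeta 3) 0 .free (Pi.single 0 ((0 : ℕ) : ℤ)) (Pi.single 0 ((3 * N : ℕ) : ℤ)) *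
              isingTwoPoint (zdGraph 3) (box 3 L) (criticalBeta 3) 0 .free (Pi.single 0 ((2 * N : ℕ) : ℤ)) (Pi.single 0 ((6 * N : ℕ) : ℤ)) *
            (isingTwoPoint (zdGraph 3) (box 3 L) (criticalBeta 3) 0 .free (Pi.single 0 ((0 : ℕ) : ℤ)) (Pi.single 0 ((2 * N : ℕ) : ℤ)) *
              isingTwoPoint (zdGraph 3) (box 3 L) (criticalBeta 3) 0 .free (Pi.single 0 ((3 * N : ℕ) : ℤ)) (Pi.single 0 ((6 * N : ℕ) : ℤ)) +
              isingTwoPoint (zdGraph 3) (box 3 L) (criticalBeta 3) 0 .free (Pi.single 0 ((0 : ℕ) : ℤ)) (Pi.single 0 ((3 * N : ℕ) : ℤ)) *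
              isingTwoPoint (zdGraph 3) (box 3 L) (criticalBeta 3) 0 .free (Pi.single 0 ((2 * N : ℕ) : ℤ)) (Pi.single 0 ((6 * N : ℕ) : ℤ)) +
              isingTwoPoint (zdGraph 3) (box 3 L) (criticalBeta 3) 0 .free (Pi.single 0 ((0 : ℕ) : ℤ)) (Pi.single 0 ((6 * N : ℕ) : ℤ)) *
              isingTwoPoint (zdGraph 3) (box 3 L) (criticalBeta 3) 0 .free (Pi.single 0 ((2 * N : ℕ) : ℤ)) (Pi.single 0 ((3 * N : ℕ) : ℤ))) -
          isingTwoPoint (zdGraph 3) (box 3 L) (criticalBeta 3) 0 .free (Pi.single 0 ((0 : ℕ) : ℤ)) (Pi.single 0 ((2 * N : ℕ) : ℤ)) *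
              isingTwoPoint (zdGraph 3) (box 3 L) (criticalBeta 3) 0 .free (Pi.single 0 ((3 * N : ℕ) : ℤ)) (Pi.single 0 ((6 * N : ℕ) : ℤ)) *
            (isingTwoPoint (zdGraph 3) (box 3 L) (criticalBeta 3) 0 .free (Pi.single 0 ((0 : ℕ) : ℤ)) (Pi.single 0 ((6 * N : ℕ) : ℤ)) *
              isingTwoPoint (zdGraph 3) (box 3 L) (criticalBeta 3) 0 .free (Pi.single 0 ((2 * N : ℕ) : ℤ)) (Pi.single 0 ((3 * N : ℕ) : ℤ))) ≤
        2 * (isingTwoPoint (zdGraph 3) (box 3 L) (criticalBeta 3) 0 .free (Pi.single 0 ((0 : ℕ) : ℤ)) (Pi.single 0 ((3 * N : ℕ) : ℤ)) *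
              isingTwoPoint (zdGraph 3) (box 3 L) (criticalBeta 3) 0 .free (Pi.single 0 ((2 * N : ℕ) : ℤ)) (Pi.single 0 ((6 * N : ℕ) : ℤ))) ^ 2 *
            (sourcedDoubleCurrentLaw 3 L (criticalBeta 3) ({(Pi.single 0 ((0 : ℕ) : ℤ))} ∆ {(Pi.single 0 ((3 * N : ℕ) : ℤ))})
              ({(Pi.single 0 ((2 * N : ℕ) : ℤ))} ∆ {(Pi.single 0 ((6 * N : ℕ) : ℤ))})).real (openConn (Pi.single 0 ((0 : ℕ) : ℤ)) (Pi.single 0 ((2 * N : ℕ) : ℤ)))) :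
    ∃ N₀ : ℕ, ∀ N : ℕ, N₀ ≤ N → 1 ≤ N →
      criticalCorr 3 4 ![Pi.single 0 ((0 : ℕ) : ℤ), Pi.single 0 ((2 * N : ℕ) : ℤ),
          Pi.single 0 ((3 * N : ℕ) : ℤ), Pi.single 0 ((6 * N : ℕ) : ℤ)] *
          (criticalCorr 3 2 ![Pi.single 0 ((0 : ℕ) : ℤ), Pi.single 0 ((3 * N : ℕ) : ℤ)] *
            criticalCorr 3 2 ![Pi.single 0 ((2 * N : ℕ) : ℤ), Pi.single 0 ((6 * N : ℕ) : ℤ)]) ≤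
        criticalCorr 3 2 ![Pi.single 0 ((0 : ℕ) : ℤ), Pi.single 0 ((2 * N : ℕ) : ℤ)] *
            criticalCorr 3 2 ![Pi.single 0 ((3 * N : ℕ) : ℤ), Pi.single 0 ((6 * N : ℕ) : ℤ)] *
          (criticalCorr 3 2 ![Pi.single 0 ((0 : ℕ) : ℤ), Pi.single 0 ((6 * N : ℕ) : ℤ)] *
            criticalCorr 3 2 ![Pi.single 0 ((2 * N : ℕ) : ℤ), Pi.single 0 ((3 * N : ℕ) : ℤ)]) :=
  ⟨N₀, fun N hN h1 => stub_balancedReduction N (hE N hN h1)⟩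

/-- **The sub-problem from the engine on the balanced family.** The engine of the line `Sketch` at the balanced gaps
`(2N, N, 3N)` for all `N ≥ N₀` (`N ≥ 1`), together with the route's other two cruxes `SubPtolemyFloor` and `MoebiusLimit`,
gives `Ising3DConformalLimit` — `stub_balancedReduction` scale by scale, then the landed transfer
`transfer_ising3D_of_balanced` (p140149: dyadic exactness at `x⋆ = (0,2,3,6)·e₁`, limit passage, and the route's `closes`
argument with its use of `Interlacing` confined to that one balanced instance). [cite: DuminilCopinICM2022, §8.1] -/
theorem ising3D_of_engineBalanced (N₀ : ℕ)
    (hE : ∀ N : ℕ, N₀ ≤ N → 1 ≤ N →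
      criticalTwoPoint 3 (Pi.single 0 ((3 * N : ℕ) : ℤ)) * criticalTwoPoint 3 (Pi.single 0 ((4 * N : ℕ) : ℤ)) ≤
        criticalTwoPoint 3 (Pi.single 0 ((2 * N : ℕ) : ℤ)) * criticalTwoPoint 3 (Pi.single 0 ((3 * N : ℕ) : ℤ)) →
      criticalTwoPoint 3 (Pi.single 0 ((3 * N : ℕ) : ℤ)) * criticalTwoPoint 3 (Pi.single 0 ((4 * N : ℕ) : ℤ)) ≤
        criticalTwoPoint 3 (Pi.single 0 ((6 * N : ℕ) : ℤ)) * criticalTwoPoint 3 (Pi.single 0 ((N : ℕ) : ℤ)) →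
      (criticalTwoPoint 3 (Pi.single 0 ((2 * N : ℕ) : ℤ)) * criticalTwoPoint 3 (Pi.single 0 ((3 * N : ℕ) : ℤ)) -
            criticalTwoPoint 3 (Pi.single 0 ((3 * N : ℕ) : ℤ)) * criticalTwoPoint 3 (Pi.single 0 ((4 * N : ℕ) : ℤ))) *
          (criticalTwoPoint 3 (Pi.single 0 ((6 * N : ℕ) : ℤ)) * criticalTwoPoint 3 (Pi.single 0 ((N : ℕ) : ℤ)) -
            criticalTwoPoint 3 (Pi.single 0 ((3 * N : ℕ) : ℤ)) * criticalTwoPoint 3 (Pi.single 0 ((4 * N : ℕ) : ℤ))) <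
        2 * (criticalTwoPoint 3 (Pi.single 0 ((3 * N : ℕ) : ℤ)) * criticalTwoPoint 3 (Pi.single 0 ((4 * N : ℕ) : ℤ))) ^ 2 →
      2 * max
            (max (criticalTwoPoint 3 (Pi.single 0 ((2 * N : ℕ) : ℤ)) * criticalTwoPoint 3 (Pi.single 0 ((3 * N : ℕ) : ℤ)) *
                criticalTwoPoint 3 (Pi.single 0 ((6 * N : ℕ) : ℤ)))
              (criticalTwoPoint 3 (Pi.single 0 ((2 * N : ℕ) : ℤ)) * criticalTwoPoint 3 (Pi.single 0 ((N : ℕ) : ℤ)) *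
                criticalTwoPoint 3 (Pi.single 0 ((4 * N : ℕ) : ℤ))))
            (max (criticalTwoPoint 3 (Pi.single 0 ((3 * N : ℕ) : ℤ)) * criticalTwoPoint 3 (Pi.single 0 ((N : ℕ) : ℤ)) *
                criticalTwoPoint 3 (Pi.single 0 ((3 * N : ℕ) : ℤ)))
              (criticalTwoPoint 3 (Pi.single 0 ((6 * N : ℕ) : ℤ)) * criticalTwoPoint 3 (Pi.single 0 ((4 * N : ℕ) : ℤ)) *
                criticalTwoPoint 3 (Pi.single 0 ((3 * N : ℕ) : ℤ)))) *
          (criticalTwoPoint 3 (Pi.single 0 ((3 * N : ℕ) : ℤ)) * criticalTwoPoint 3 (Pi.single 0 ((4 * N : ℕ) : ℤ))) <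
        (criticalTwoPoint 3 (Pi.single 0 ((2 * N : ℕ) : ℤ)) * criticalTwoPoint 3 (Pi.single 0 ((3 * N : ℕ) : ℤ)) +
            criticalTwoPoint 3 (Pi.single 0 ((3 * N : ℕ) : ℤ)) * criticalTwoPoint 3 (Pi.single 0 ((4 * N : ℕ) : ℤ)) +
            criticalTwoPoint 3 (Pi.single 0 ((6 * N : ℕ) : ℤ)) * criticalTwoPoint 3 (Pi.single 0 ((N : ℕ) : ℤ))) *
          (criticalTwoPoint 3 (Pi.single 0 ((3 * N : ℕ) : ℤ)) * criticalTwoPoint 3 (Pi.single 0 ((4 * N : ℕ) : ℤ))) -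
        criticalTwoPoint 3 (Pi.single 0 ((2 * N : ℕ) : ℤ)) * criticalTwoPoint 3 (Pi.single 0 ((3 * N : ℕ) : ℤ)) *
          (criticalTwoPoint 3 (Pi.single 0 ((6 * N : ℕ) : ℤ)) * criticalTwoPoint 3 (Pi.single 0 ((N : ℕ) : ℤ))) →
      ∀ᶠ L : ℕ in atTop,
        isingTwoPoint (zdGraph 3) (box 3 L) (criticalBeta 3) 0 .free (Pi.single 0 ((0 : ℕ) : ℤ)) (Pi.single 0 ((3 * N : ℕ) : ℤ)) *
              isingTwoPoint (zdGraph 3) (box 3 L) (criticalBeta 3) 0 .free (Pi.single 0 ((2 * N : ℕ) : ℤ)) (Pi.single 0 ((6 * N : ℕ) : ℤ)) *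
            (isingTwoPoint (zdGraph 3) (box 3 L) (criticalBeta 3) 0 .free (Pi.single 0 ((0 : ℕ) : ℤ)) (Pi.single 0 ((2 * N : ℕ) : ℤ)) *
              isingTwoPoint (zdGraph 3) (box 3 L) (criticalBeta 3) 0 .free (Pi.single 0 ((3 * N : ℕ) : ℤ)) (Pi.single 0 ((6 * N : ℕ) : ℤ)) +
              isingTwoPoint (zdGraph 3) (box 3 L) (criticalBeta 3) 0 .free (Pi.single 0 ((0 : ℕ) : ℤ)) (Pi.single 0 ((3 * N : ℕ) : ℤ)) *
              isingTwoPoint (zdGraph 3) (box 3 L) (criticalBeta 3) 0 .free (Pi.single 0 ((2 * N : ℕ) : ℤ)) (Pi.single 0 ((6 * N : ℕ) : ℤ)) +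
              isingTwoPoint (zdGraph 3) (box 3 L) (criticalBeta 3) 0 .free (Pi.single 0 ((0 : ℕ) : ℤ)) (Pi.single 0 ((6 * N : ℕ) : ℤ)) *
              isingTwoPoint (zdGraph 3) (box 3 L) (criticalBeta 3) 0 .free (Pi.single 0 ((2 * N : ℕ) : ℤ)) (Pi.single 0 ((3 * N : ℕ) : ℤ))) -
          isingTwoPoint (zdGraph 3) (box 3 L) (criticalBeta 3) 0 .free (Pi.single 0 ((0 : ℕ) : ℤ)) (Pi.single 0 ((2 * N : ℕ) : ℤ)) *
              isingTwoPoint (zdGraph 3) (box 3 L) (criticalBeta 3) 0 .free (Pi.single 0 ((3 * N : ℕ) : ℤ)) (Pi.single 0 ((6 * N : ℕ) : ℤ)) *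
            (isingTwoPoint (zdGraph 3) (box 3 L) (criticalBeta 3) 0 .free (Pi.single 0 ((0 : ℕ) : ℤ)) (Pi.single 0 ((6 * N : ℕ) : ℤ)) *
              isingTwoPoint (zdGraph 3) (box 3 L) (criticalBeta 3) 0 .free (Pi.single 0 ((2 * N : ℕ) : ℤ)) (Pi.single 0 ((3 * N : ℕ) : ℤ))) ≤
        2 * (isingTwoPoint (zdGraph 3) (box 3 L) (criticalBeta 3) 0 .free (Pi.single 0 ((0 : ℕ) : ℤ)) (Pi.single 0 ((3 * N : ℕ) : ℤ)) *
              isingTwoPoint (zdGraph 3) (box 3 L) (criticalBeta 3) 0 .free (Pi.single 0 ((2 * N : ℕ) : ℤ)) (Pi.single 0 ((6 * N : ℕ) : ℤ))) ^ 2 *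
            (sourcedDoubleCurrentLaw 3 L (criticalBeta 3) ({(Pi.single 0 ((0 : ℕ) : ℤ))} ∆ {(Pi.single 0 ((3 * N : ℕ) : ℤ))})
              ({(Pi.single 0 ((2 * N : ℕ) : ℤ))} ∆ {(Pi.single 0 ((6 * N : ℕ) : ℤ))})).real (openConn (Pi.single 0 ((0 : ℕ) : ℤ)) (Pi.single 0 ((2 * N : ℕ) : ℤ))))
    (hF : SubPtolemyFloor) (hML : MoebiusLimit) : _root_.Ising3DConformalLimit :=
  transfer_ising3D_of_balanced N₀ (fun N hN h1 => stub_balancedReduction N (hE N hN h1)) hF hML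

end Summit.CriticalPhenomena.Ising3DConformalLimit.Cruxes.Interlacing.Sketch

end
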